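/-
Copyright (c) 2026. All rights reserved.
Released under Apache 2.0 license as described in the file LICENSE.
Authors: abc-iut cell, prover seat abc-iut-w4-d095 (wave 4), over the MLF model of abc-iut-L4-t9
(`MLFGaloisModelCategories.lean`, `MLFLogFrobeniusFunctors.lean`, `MLFGaloisArithmeticData.lean`), the `p`-adic
logarithm files of abc-iut-L4-t2 / abc-iut-L6-d2 and the graph of abc-iut-L4-t3 (`LogFrobeniusGraphs.lean`).
-/
import Literature.AnabelianGeometry.AbsoluteAnabelian.AbsTopIII.MLFLogFrobeniusFunctors
import Literature.AnabelianGeometry.AbsoluteAnabelian.MonoidKummerMapsTCGLiftProofs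
import Literature.AnabelianGeometry.AbsoluteAnabelian.GaloisPadicLogInstance
import HarnessLib

/-!
# [AbsTopIII] Definition 5.4 (iii): the arrows of the nonarchimedean graph `Γ⃗^log_v` AT THE MLF MODEL

S. Mochizuki, *Topics in absolute anabelian geometry III: global reconstruction algorithms*, J. Math. Sci. Univ.
Tokyo 22 (2015) 939–1156 [MochizukiAbsTopIII2015]; locators = pages of the author's manuscript
(`paper:url-5493eb38cbb7`): Def 5.4 (iii) p. 126 (the nonarchimedean graph `Γ⃗^log_v`:
`𝒪^×_k̄ ↪ k̄^× ↪ k̄`, the shell-arrow `𝒪^×_k̄ → k~`, `k̄^× → (k̄^×)^pf`, `k~ →(id) k~`, `k~ ↪ (k̄^×)^pf`), Def 3.1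
(i)/(iv) pp. 66–69 (`log_k̄ : 𝒪^×_k̄ → k̄`, `k~ := (𝒪^×_k̄)^pf`, `λ^×`, `λ^{×pf}`), Def 3.1 (ii) p. 67 (`TS`-pairs
`(Π ↷ M)` and their arithmetic Galois groups).

abc-iut-L4-t9's MODEL of Def 3.1 realises two of the six vertices of `Γ⃗^log_v` over the model `TF`-pairs
`A = (Π_k ↠ G_k ↷ ℚ̄_p)` (`TFModel p`): `λ^×(A) = (Π ↷ k̄^×)`, `λ^{×pf}(A) = (Π ↷ (k̄^×)^pf)`, with `ι_×`, `ι_log`.  This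
file adds the remaining vertices and arrows of Def 5.4 (iii) in the SAME conventions (discrete arithmetic data,
action through `ε_k`, `k~ = k̄` in log-coordinates, Rmk 3.1.1):
* `TFModel.lamUnits` — `(Π ↷ 𝒪^×_k̄)` (carrier `UnitsCarrier p = 𝒪^×_{ℚ̄_p}`, abc-iut-L4-t2's `unitSubmonoid`);
  its arithmetic Galois group is that of `A` (`lamUnitsObj_actionKer`, by the FAITHFULNESS of `G_k` on `𝒪^×_k̄`,
  `MLFClosure.algEquiv_eq_one_of_forall_unitSubmonoid`);
* `TFModel.lamAdd` — `(Π ↷ k̄)`, the space-link vertex `k̄` AND (log-coordinates) the two `k~`-vertices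
  (carrier `AddCarrier p = ℚ̄_p`);
* the arrows: `iotaUnitsToTimes` (`𝒪^× ↪ k̄^×`), `iotaTimesToAdd` (`k̄^× ↪ k̄`), `iotaShell` (the shell-arrow
  `𝒪^× →(log_k̄) k~`, the GENUINE `p`-adic logarithm `padicLog p` of abc-iut-L4-t2/L6-d2), `iotaPostLogId`
  (`k~ →(id) k~`), `iotaAddToPf` (`k~ ↪ (k̄^×)^pf` in log-coordinates: `y ↦ [log_k̄⁻¹(y)]`, of which abc-iut-L4-t9's
  `ι_log` is the restriction to `k̄^×`, `iotaLogMap_eq_addToPf`), and abc-iut-L4-t9's `iotaTimes` (`k̄^× → (k̄^×)^pf`);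
* the set-theoretic content used by [AbsTopIII] Cor 5.5 (iv) (`LogFrobeniusLogWallNonarchOrigin.lean`): the
  inclusions and the identity are INJECTIVE on arithmetic data, the shell-arrow is NOT (`log_k̄(−1) = log_k̄(1)`).

HONEST FRAMING: a kernel MODEL (abc-iut-L4-t9's conventions: fixed closure `ℚ̄_p`, discrete topologies, no
"strictly Belyi type" condition); the §5 setting `LogFrobeniusSetting` with these nonarchimedean components is NOT
assembled here (its `An•`-row needs the mono-anabelian input, abc-iut-L4-t5's `AnabelianInput`, as for Cor 3.6);
refereed pre-IUT material; nothing here bears on [IUTchIII] Cor. 3.12; no side taken; typed ≠ proved.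
-/

set_option autoImplicit false

noncomputable section

namespace Literature.AnabelianGeometry.AbsoluteAnabelian.AbsTopIII

open CategoryTheory

variable {p : ℕ} [hp : Fact p.Prime]

/-! ## The arithmetic data `𝒪^×_k̄` and `k̄` (discrete, Rmk 3.1.1) -/

variable (p) in
/-- The arithmetic datum `𝒪^×_k̄ = 𝒪^×_{ℚ̄_p}` (abc-iut-L4-t2's `unitSubmonoid`), as a bare type carrying the DISCRETE
topology. [cite: MochizukiAbsTopIII2015, Definition 5.4 (iii) p.126] -/
def UnitsCarrier : Type := ↥(unitSubmonoid ℚ_[p] (PadicAlgCl p))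

/-- The discrete topology on `𝒪^×_k̄`. [cite: MochizukiAbsTopIII2015, Remark 3.1.1 p.70] -/
instance : TopologicalSpace (UnitsCarrier p) := ⊥
/-- `𝒪^×_k̄` is discrete. [cite: MochizukiAbsTopIII2015, Remark 3.1.1 p.70] -/
instance : DiscreteTopology (UnitsCarrier p) := ⟨rfl⟩
/-- A discrete space is locally compact (so `𝒪^×_k̄` is an object of `TS`). [cite: MochizukiAbsTopIII2015, Definition 3.1 (i) p.66] -/
instance : LocallyCompactSpace (UnitsCarrier p) :=
  ⟨fun x _ hn => ⟨{x}, by rw [nhds_discrete]; exact Filter.mem_pure.2 rfl,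
    Set.singleton_subset_iff.2 (mem_of_mem_nhds hn), isCompact_singleton⟩⟩

/-- An element of `𝒪^×_k̄` as an element of `ℚ̄_p`. [cite: MochizukiAbsTopIII2015, Definition 5.4 (iii) p.126] -/
def UnitsCarrier.val (u : UnitsCarrier p) : PadicAlgCl p := u.1
/-- An element of `𝒪^×_k̄` is a unit integer. [cite: MochizukiAbsTopIII2015, Definition 3.1 (i) p.66] -/
theorem UnitsCarrier.val_mem (u : UnitsCarrier p) : u.val ∈ unitSubmonoid ℚ_[p] (PadicAlgCl p) := u.2
/-- Elements of `𝒪^×_k̄` are determined by their values in `ℚ̄_p`. [cite: MochizukiAbsTopIII2015, Definition 5.4 (iii) p.126] -/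
theorem UnitsCarrier.ext {u v : UnitsCarrier p} (h : u.val = v.val) : u = v := Subtype.ext h
/-- Build an element of `𝒪^×_k̄` from a unit integer. [cite: MochizukiAbsTopIII2015, Definition 3.1 (i) p.66] -/
def UnitsCarrier.mk (x : PadicAlgCl p) (hx : x ∈ unitSubmonoid ℚ_[p] (PadicAlgCl p)) : UnitsCarrier p := ⟨x, hx⟩

variable (p) in
/-- The arithmetic datum `k̄ = ℚ̄_p` (the space-link vertex, and the two vertices `k~` in log-coordinates), as a bare
type carrying the DISCRETE topology. [cite: MochizukiAbsTopIII2015, Definition 5.4 (iii) p.126] -/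
def AddCarrier : Type := PadicAlgCl p

/-- The discrete topology on `k̄`. [cite: MochizukiAbsTopIII2015, Remark 3.1.1 p.70] -/
instance : TopologicalSpace (AddCarrier p) := ⊥
/-- `k̄` (as arithmetic datum) is discrete. [cite: MochizukiAbsTopIII2015, Remark 3.1.1 p.70] -/
instance : DiscreteTopology (AddCarrier p) := ⟨rfl⟩
/-- A discrete space is locally compact. [cite: MochizukiAbsTopIII2015, Definition 3.1 (i) p.66] -/
instance : LocallyCompactSpace (AddCarrier p) :=
  ⟨fun x _ hn => ⟨{x}, by rw [nhds_discrete]; exact Filter.mem_pure.2 rfl,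
    Set.singleton_subset_iff.2 (mem_of_mem_nhds hn), isCompact_singleton⟩⟩

/-- An element of the arithmetic datum `k̄` as an element of `ℚ̄_p`. [cite: MochizukiAbsTopIII2015, Definition 5.4 (iii) p.126] -/
def AddCarrier.val (y : AddCarrier p) : PadicAlgCl p := y
/-- An element of `ℚ̄_p` as an element of the arithmetic datum `k̄`. [cite: MochizukiAbsTopIII2015, Definition 5.4 (iii) p.126] -/
def AddCarrier.of (y : PadicAlgCl p) : AddCarrier p := y
/-- Elements of the datum `k̄` are determined by their values. [cite: MochizukiAbsTopIII2015, Definition 5.4 (iii) p.126] -/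
theorem AddCarrier.ext {x y : AddCarrier p} (h : x.val = y.val) : x = y := h

/-- The action of `σ ∈ Gal(ℚ̄_p/ℚ_p)` on `𝒪^×_k̄` (units are Galois-stable, abc-iut-L4-t2's `smul_mem_unitSubmonoid`).
[cite: MochizukiAbsTopIII2015, Definition 3.1 (i) p.66] -/
def unitsSubGal (σ : PadicAlgCl p ≃ₐ[ℚ_[p]] PadicAlgCl p) (u : UnitsCarrier p) : UnitsCarrier p :=
  ⟨σ u.val, smul_mem_unitSubmonoid σ u.val_mem⟩

/-- The value of `σ · u` is `σ(u)`. [cite: MochizukiAbsTopIII2015, Definition 3.1 (i) p.66] -/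
@[simp] theorem unitsSubGal_val (σ : PadicAlgCl p ≃ₐ[ℚ_[p]] PadicAlgCl p) (u : UnitsCarrier p) :
    (unitsSubGal σ u).val = σ u.val := rfl

namespace TFModel

variable (A : TFModel p)

/-- The `Π_k`-action on `𝒪^×_k̄` through `ε_k`. [cite: MochizukiAbsTopIII2015, Definition 5.4 (iii) p.126] -/
instance unitsAction : MulAction A.pair.Pi (UnitsCarrier p) where
  smul g u := unitsSubGal (A.augQ g) u
  one_smul u := UnitsCarrier.ext (by
    change (A.augQ 1) u.val = u.val
    rw [augQ_one]; rfl)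
  mul_smul g h u := UnitsCarrier.ext (by
    change (A.augQ (g * h)) u.val = (A.augQ g) ((A.augQ h) u.val)
    rw [augQ_mul]; rfl)

/-- The `Π_k`-action on `k̄` through `ε_k`. [cite: MochizukiAbsTopIII2015, Definition 5.4 (iii) p.126] -/
instance addAction : MulAction A.pair.Pi (AddCarrier p) where
  smul g y := AddCarrier.of ((A.augQ g) y.val)
  one_smul y := AddCarrier.ext (by
    change (A.augQ 1) y.val = y.val
    rw [augQ_one]; rfl)
  mul_smul g h y := AddCarrier.ext (by
    change (A.augQ (g * h)) y.val = (A.augQ g) ((A.augQ h) y.val)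
    rw [augQ_mul]; rfl)

/-- The stabiliser in `Π_k` of `y ∈ k̄` is open (preimage under the continuous `ε_k` of the Krull-open stabiliser).
[cite: MochizukiAbsTopIII2015, Definition 3.1 (i) p.67] -/
theorem isOpen_stabilizer_add (y : AddCarrier p) :
    IsOpen (MulAction.stabilizer A.pair.Pi y : Set A.pair.Pi) := by
  haveI := A.isAlgebraic
  have h := A.D.isOpen_stabilizer_comp y.val
  have hset : (MulAction.stabilizer A.pair.Pi y : Set A.pair.Pi) =
      (MulAction.stabilizer (PadicAlgCl p ≃ₐ[A.k] PadicAlgCl p) y.val :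
        Set (PadicAlgCl p ≃ₐ[A.k] PadicAlgCl p)).preimage A.D.aug := by
    ext g
    change AddCarrier.of ((A.augQ g) y.val) = y ↔
      A.D.aug g ∈ (MulAction.stabilizer (PadicAlgCl p ≃ₐ[A.k] PadicAlgCl p) y.val :
        Set (PadicAlgCl p ≃ₐ[A.k] PadicAlgCl p))
    rw [SetLike.mem_coe, MulAction.mem_stabilizer_iff, AlgEquiv.smul_def]
    exact Iff.rfl
  rw [hset]
  exact h

/-- The stabiliser in `Π_k` of `u ∈ 𝒪^×_k̄` is open. [cite: MochizukiAbsTopIII2015, Definition 3.1 (i) p.67] -/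
theorem isOpen_stabilizer_units (u : UnitsCarrier p) :
    IsOpen (MulAction.stabilizer A.pair.Pi u : Set A.pair.Pi) := by
  have h := A.isOpen_stabilizer_add (AddCarrier.of u.val)
  have hset : (MulAction.stabilizer A.pair.Pi u : Set A.pair.Pi) =
      (MulAction.stabilizer A.pair.Pi (AddCarrier.of u.val) : Set A.pair.Pi) := by
    ext g
    rw [SetLike.mem_coe, SetLike.mem_coe, MulAction.mem_stabilizer_iff, MulAction.mem_stabilizer_iff]
    exact ⟨fun hg => AddCarrier.ext (congrArg UnitsCarrier.val hg), fun hg => UnitsCarrier.ext (congrArg AddCarrier.val hg)⟩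
  rw [hset]
  exact h

/-- **`(Π_k ↷ 𝒪^×_k̄)`** as a `TS`-pair (discrete space, action through `ε_k`). [cite: MochizukiAbsTopIII2015, Definition 5.4 (iii) p.126] -/
abbrev lamUnitsObj : TSObj :=
  ⟨{ Pi := A.pair.Pi, M := UnitsCarrier p, instAction := A.unitsAction,
     continuous_smul :=
       ((continuousSMul_iff_stabilizer_isOpen (M := A.pair.Pi) (X := UnitsCarrier p)).2
         A.isOpen_stabilizer_units).continuous_smul }⟩

/-- **`(Π_k ↷ k̄)`** as a `TS`-pair (discrete space, action through `ε_k`). [cite: MochizukiAbsTopIII2015, Definition 5.4 (iii) p.126] -/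
abbrev lamAddObj : TSObj :=
  ⟨{ Pi := A.pair.Pi, M := AddCarrier p, instAction := A.addAction,
     continuous_smul :=
       ((continuousSMul_iff_stabilizer_isOpen (M := A.pair.Pi) (X := AddCarrier p)).2
         A.isOpen_stabilizer_add).continuous_smul }⟩

/-- **The arithmetic Galois group of `(Π ↷ k̄)` is that of `A`** (same action). [cite: MochizukiAbsTopIII2015, Definition 3.1 (ii) p.67] -/
theorem lamAddObj_actionKer : A.lamAddObj.actionKer = A.pair.actionKer := by
  ext g
  rw [TSObj.mem_actionKer_iff, mem_pair_actionKer_iff]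
  exact ⟨fun h x => congrArg AddCarrier.val (h (AddCarrier.of x)), fun h y => AddCarrier.ext (h y.val)⟩

/-- **The arithmetic Galois group of `(Π ↷ 𝒪^×_k̄)` is that of `A`**: `g` acts trivially on `𝒪^×_k̄` iff it acts
trivially on `k̄` — the FAITHFULNESS of `G_k` on `𝒪^×_k̄` (`MLFClosure.algEquiv_eq_one_of_forall_unitSubmonoid`, at the
`ℚ_p`-model `MLFClosure.padic p`). [cite: MochizukiAbsTopIII2015, Definition 3.1 (ii) p.67] -/
theorem lamUnitsObj_actionKer : A.lamUnitsObj.actionKer = A.pair.actionKer := by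
  ext g
  rw [TSObj.mem_actionKer_iff, mem_pair_actionKer_iff]
  constructor
  · intro h
    have hσ : A.augQ g = 1 :=
      (MLFClosure.padic p).algEquiv_eq_one_of_forall_unitSubmonoid (A.augQ g)
        (fun x hx => congrArg UnitsCarrier.val (h (UnitsCarrier.mk x hx)))
    intro x
    rw [hσ]; rfl
  · intro h u
    exact UnitsCarrier.ext (h u.val)

variable {A} {B : TFModel p}

/-- `(Π ↷ 𝒪^×_k̄)` on a Galois-isomorphism `φ`: `(φ_Π, φ_M|_{𝒪^×})`. [cite: MochizukiAbsTopIII2015, Definition 5.4 (iii) p.126] -/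
def lamUnitsMap (f : A ⟶ B) : A.lamUnitsObj ⟶ B.lamUnitsObj where
  homPi := (f : Hom A B).hom.homPi
  continuous_homPi := (f : Hom A B).hom.continuous_homPi
  bijective_homPi := (f : Hom A B).bijective
  isOpenMap_homPi := (f : Hom A B).isOpenMap
  homM := unitsSubGal (f : Hom A B).galois
  continuous_homM :=
    (continuous_of_discreteTopology : Continuous (unitsSubGal (f : Hom A B).galois : UnitsCarrier p → _))
  smul_comm g u := UnitsCarrier.ext (by
    change (f : Hom A B).galois ((A.augQ g) u.val) = (B.augQ ((f : Hom A B).hom.homPi g)) ((f : Hom A B).galois u.val)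
    rw [← AlgEquiv.mul_apply, ← AlgEquiv.mul_apply, Hom.galois_mul_augQ])
  comap_ker := by rw [lamUnitsObj_actionKer, lamUnitsObj_actionKer]; exact (f : Hom A B).hom.comap_ker

/-- `(Π ↷ k̄)` on a Galois-isomorphism `φ`: `(φ_Π, φ_M)`. [cite: MochizukiAbsTopIII2015, Definition 5.4 (iii) p.126] -/
def lamAddMap (f : A ⟶ B) : A.lamAddObj ⟶ B.lamAddObj where
  homPi := (f : Hom A B).hom.homPi
  continuous_homPi := (f : Hom A B).hom.continuous_homPi
  bijective_homPi := (f : Hom A B).bijective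
  isOpenMap_homPi := (f : Hom A B).isOpenMap
  homM y := AddCarrier.of ((f : Hom A B).galois y.val)
  continuous_homM :=
    (continuous_of_discreteTopology :
      Continuous (fun y : AddCarrier p => AddCarrier.of (p := p) ((f : Hom A B).galois y.val)))
  smul_comm g y := AddCarrier.ext (by
    change (f : Hom A B).galois ((A.augQ g) y.val) = (B.augQ ((f : Hom A B).hom.homPi g)) ((f : Hom A B).galois y.val)
    rw [← AlgEquiv.mul_apply, ← AlgEquiv.mul_apply, Hom.galois_mul_augQ])
  comap_ker := by rw [lamAddObj_actionKer, lamAddObj_actionKer]; exact (f : Hom A B).hom.comap_ker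

variable (p)

/-- **The functor `(Π ↷ k̄) ↦ (Π ↷ 𝒪^×_k̄)`** (the vertex `𝒪^×_k̄` of `Γ⃗^log_v`). [cite: MochizukiAbsTopIII2015, Definition 5.4 (iii) p.126] -/
def lamUnits : TFModel p ⥤ TSObj where
  obj A := A.lamUnitsObj
  map f := lamUnitsMap f
  map_id _ := TSObj.Hom.ext rfl (funext fun _ => UnitsCarrier.ext rfl)
  map_comp _ _ := TSObj.Hom.ext rfl (funext fun _ => UnitsCarrier.ext rfl)

/-- **The functor `(Π ↷ k̄) ↦ (Π ↷ k̄)`** (the space-link vertex `k̄`, and the vertices `k~` in log-coordinates).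
[cite: MochizukiAbsTopIII2015, Definition 5.4 (iii) p.126] -/
def lamAdd : TFModel p ⥤ TSObj where
  obj A := A.lamAddObj
  map f := lamAddMap f
  map_id _ := TSObj.Hom.ext rfl (funext fun _ => AddCarrier.ext rfl)
  map_comp _ _ := TSObj.Hom.ext rfl (funext fun _ => AddCarrier.ext rfl)

/-! ## The arrows of `Γ⃗^log_v` (Def 5.4 (iii)) -/
variable {p}

/-- A unit integer as an element of `k̄^×`. [cite: MochizukiAbsTopIII2015, Definition 5.4 (iii) p.126] -/
def UnitsCarrier.toTimes (u : UnitsCarrier p) : TimesCarrier p :=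
  TimesCarrier.ofUnits (Units.mk0 u.val (ne_zero_of_mem_unitSubmonoid u.val_mem))

/-- The value of `u` in `k̄^×` is its value in `k̄`. [cite: MochizukiAbsTopIII2015, Definition 5.4 (iii) p.126] -/
@[simp] theorem UnitsCarrier.coe_toTimes (u : UnitsCarrier p) :
    ((UnitsCarrier.toTimes u).toUnits : PadicAlgCl p) = u.val := rfl

variable (p)

/-- **`𝒪^×_k̄ ↪ k̄^×`** (identity on `Π`). [cite: MochizukiAbsTopIII2015, Definition 5.4 (iii) p.126] -/
def iotaUnitsToTimes : lamUnits p ⟶ lamTimes p where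
  app A :=
    { homPi := MonoidHom.id _
      continuous_homPi := continuous_id
      bijective_homPi := Function.bijective_id
      isOpenMap_homPi := IsOpenMap.id
      homM := UnitsCarrier.toTimes
      continuous_homM :=
        (continuous_of_discreteTopology : Continuous (UnitsCarrier.toTimes : UnitsCarrier p → TimesCarrier p))
      smul_comm := fun _ _ => TimesCarrier.ext rfl
      comap_ker := by
        change (A.lamTimesObj.actionKer).comap (MonoidHom.id _) = A.lamUnitsObj.actionKer
        rw [Subgroup.comap_id, lamTimesObj_actionKer, lamUnitsObj_actionKer] }
  naturality := fun _ _ _ => TSObj.Hom.ext rfl (funext fun _ => TimesCarrier.ext rfl)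

/-- **`k̄^× ↪ k̄`** (into the space-link vertex; identity on `Π`). [cite: MochizukiAbsTopIII2015, Definition 5.4 (iii) p.126] -/
def iotaTimesToAdd : lamTimes p ⟶ lamAdd p where
  app A :=
    { homPi := MonoidHom.id _
      continuous_homPi := continuous_id
      bijective_homPi := Function.bijective_id
      isOpenMap_homPi := IsOpenMap.id
      homM := fun u => AddCarrier.of (u.toUnits : PadicAlgCl p)
      continuous_homM :=
        (continuous_of_discreteTopology :
          Continuous (fun u : TimesCarrier p => AddCarrier.of (p := p) (u.toUnits : PadicAlgCl p)))
      smul_comm := fun _ _ => AddCarrier.ext rfl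
      comap_ker := by
        change (A.lamAddObj.actionKer).comap (MonoidHom.id _) = A.lamTimesObj.actionKer
        rw [Subgroup.comap_id, lamAddObj_actionKer, lamTimesObj_actionKer] }
  naturality := fun _ _ _ => TSObj.Hom.ext rfl (funext fun _ => AddCarrier.ext rfl)

/-- **The shell-arrow `𝒪^×_k̄ → k~`: the GENUINE `p`-adic logarithm `log_k̄`** (`padicLog p`; in log-coordinates
`k~ = k̄`), `Π`-equivariant by `log_smul`, natural in `A` by the same equivariance applied to `σ_φ`.
[cite: MochizukiAbsTopIII2015, Definition 5.4 (iii) p.126] -/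
def iotaShell : lamUnits p ⟶ lamAdd p where
  app A :=
    { homPi := MonoidHom.id _
      continuous_homPi := continuous_id
      bijective_homPi := Function.bijective_id
      isOpenMap_homPi := IsOpenMap.id
      homM := fun u => AddCarrier.of ((padicLog p).log u.val)
      continuous_homM :=
        (continuous_of_discreteTopology :
          Continuous (fun u : UnitsCarrier p => AddCarrier.of (p := p) ((padicLog p).log u.val)))
      smul_comm := fun g u => AddCarrier.ext (by
        change (padicLog p).log ((A.augQ g) u.val) = (A.augQ g) ((padicLog p).log u.val)
        exact (padicLog p).log_smul (A.augQ g) u.val u.val_mem)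
      comap_ker := by
        change (A.lamAddObj.actionKer).comap (MonoidHom.id _) = A.lamUnitsObj.actionKer
        rw [Subgroup.comap_id, lamAddObj_actionKer, lamUnitsObj_actionKer] }
  naturality := fun _ _ f => TSObj.Hom.ext rfl (funext fun u => AddCarrier.ext
    ((padicLog p).log_smul (Hom.galois (f : Hom _ _)) u.val u.val_mem))

/-- **The post-log arrow `k~ →(id) k~`** (`Λ` at the post-log vertex is `log_{TF,TF} = 𝟭` in log-coordinates).
[cite: MochizukiAbsTopIII2015, Definition 5.4 (iii) p.126] -/
def iotaPostLogId : 𝟭 (TFModel p) ⋙ lamAdd p ⟶ lamAdd p := (lamAdd p).leftUnitor.hom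

/-- `k~ → (k̄^×)^pf` in log-coordinates on arithmetic data: `y ↦ [log_k̄⁻¹(y)]`, the class in `(k̄^×)^pf` of any unit
with logarithm `y` (well defined: `ker log_k̄ = 𝒪^μ_k̄`; abc-iut-L6-d2's `logEquiv`).
[cite: MochizukiAbsTopIII2015, Definition 3.1 (iv) p.69] -/
def addToPf (y : AddCarrier p) : TimesPfCarrier p :=
  unitsPfIncl ((padicLog p).logEquiv.symm (Multiplicative.ofAdd y.val))

/-- abc-iut-L4-t9's `ι_log` on arithmetic data IS `addToPf` restricted to `k̄^× ⊆ k̄ = k~` (definitional).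
[cite: MochizukiAbsTopIII2015, Definition 3.1 (iv) p.69] -/
theorem iotaLogMap_eq_addToPf (u : TimesCarrier p) :
    iotaLogMap u = addToPf p (AddCarrier.of (u.toUnits : PadicAlgCl p)) := rfl

/-- Equivariance of `addToPf`: `[log_k̄⁻¹(σ y)] = σ · [log_k̄⁻¹(y)]` (because `log_k̄` is `Gal(ℚ̄_p/ℚ_p)`-equivariant;
same computation as abc-iut-L4-t9's `iotaLogMap_unitsGal`). [cite: MochizukiAbsTopIII2015, Definition 3.1 (iv) p.69] -/
theorem addToPf_smul (σ : PadicAlgCl p ≃ₐ[ℚ_[p]] PadicAlgCl p) (y : AddCarrier p) :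
    addToPf p (AddCarrier.of (σ y.val)) = unitsPfGal σ (addToPf p y) := by
  have hσx : (padicLog p).logEquiv.symm (Multiplicative.ofAdd (σ y.val)) =
      unitsModTorsionGaloisMap σ ((padicLog p).logEquiv.symm (Multiplicative.ofAdd y.val)) := by
    apply (padicLog p).logEquiv.injective
    rw [MulEquiv.apply_symm_apply, (padicLog p).logEquiv_unitsModTorsionGaloisMap σ,
      MulEquiv.apply_symm_apply, toAdd_ofAdd]
  change unitsPfIncl ((padicLog p).logEquiv.symm (Multiplicative.ofAdd (σ y.val))) =
    unitsPfGal σ (unitsPfIncl ((padicLog p).logEquiv.symm (Multiplicative.ofAdd y.val)))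
  rw [hσx]
  generalize (padicLog p).logEquiv.symm (Multiplicative.ofAdd y.val) = x
  induction x using QuotientGroup.induction_on with
  | H v => rfl

/-- **`k~ ↪ (k̄^×)^pf`** in log-coordinates (identity on `Π`). [cite: MochizukiAbsTopIII2015, Definition 5.4 (iii) p.126] -/
def iotaAddToPf : lamAdd p ⟶ lamTimesPf p where
  app A :=
    { homPi := MonoidHom.id _
      continuous_homPi := continuous_id
      bijective_homPi := Function.bijective_id
      isOpenMap_homPi := IsOpenMap.id
      homM := addToPf p
      continuous_homM := (continuous_of_discreteTopology : Continuous (addToPf p))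
      smul_comm := fun g y => addToPf_smul p (A.augQ g) y
      comap_ker := by
        change (A.lamTimesPfObj.actionKer).comap (MonoidHom.id _) = A.lamAddObj.actionKer
        rw [Subgroup.comap_id, lamTimesPfObj_actionKer, lamAddObj_actionKer] }
  naturality := fun _ _ f => TSObj.Hom.ext rfl (funext fun y => addToPf_smul p (Hom.galois (f : Hom _ _)) y)

/-! ## Set-theoretic content for Cor 5.5 (iv): injective inclusions, non-injective logarithm -/
/-- **`𝒪^×_k̄ ↪ k̄^×` is injective on arithmetic data.** [cite: MochizukiAbsTopIII2015, Definition 5.4 (iii) p.126] -/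
theorem iotaUnitsToTimes_injective (A : TFModel p) : Function.Injective ((iotaUnitsToTimes p).app A).homM :=
  fun _ _ h => UnitsCarrier.ext (congrArg (fun w : TimesCarrier p => (w.toUnits : PadicAlgCl p)) h)

/-- **`k̄^× ↪ k̄` is injective on arithmetic data.** [cite: MochizukiAbsTopIII2015, Definition 5.4 (iii) p.126] -/
theorem iotaTimesToAdd_injective (A : TFModel p) : Function.Injective ((iotaTimesToAdd p).app A).homM :=
  fun _ _ h => TimesCarrier.ext (congrArg AddCarrier.val h)

/-- **`k~ →(id) k~` is injective on arithmetic data.** [cite: MochizukiAbsTopIII2015, Definition 5.4 (iii) p.126] -/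
theorem iotaPostLogId_injective (A : TFModel p) : Function.Injective ((iotaPostLogId p).app A).homM :=
  fun _ _ h => h

/-- **The shell-arrow `𝒪^×_k̄ →(log_k̄) k~` is NOT injective on arithmetic data**: `log_k̄(−1) = log_k̄(1) = 0` and
`−1 ≠ 1` in `ℚ̄_p` — `log_k̄` kills the torsion `𝒪^μ_k̄` (Def 3.1 (i)); the Lemma-3.4 content used by Cor 5.5 (iv).
[cite: MochizukiAbsTopIII2015, Definition 3.1 (i) p.66] -/
theorem iotaShell_not_injective (A : TFModel p) : ¬ Function.Injective ((iotaShell p).app A).homM := by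
  haveI : CharZero (PadicAlgCl p) := charZero_of_injective_algebraMap (algebraMap ℚ_[p] (PadicAlgCl p)).injective
  intro h
  have hneg : (-1 : PadicAlgCl p) ∈ unitSubmonoid ℚ_[p] (PadicAlgCl p) :=
    ⟨Subalgebra.neg_mem _ (Subalgebra.one_mem _), -1, Subalgebra.neg_mem _ (Subalgebra.one_mem _), by ring⟩
  have h1 : (padicLog p).log (1 : PadicAlgCl p) = 0 :=
    (padicLog p).log_eq_zero_of_pow_eq_one (unitSubmonoid ℚ_[p] (PadicAlgCl p)).one_mem one_pos (one_pow 1)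
  have h2 : (padicLog p).log (-1 : PadicAlgCl p) = 0 :=
    (padicLog p).log_eq_zero_of_pow_eq_one hneg two_pos (by norm_num)
  have h3 : UnitsCarrier.mk (-1 : PadicAlgCl p) hneg = UnitsCarrier.mk 1 (unitSubmonoid ℚ_[p] (PadicAlgCl p)).one_mem :=
    h (AddCarrier.ext (by change (padicLog p).log (-1) = (padicLog p).log 1; rw [h1, h2]))
  have h4 : (-1 : PadicAlgCl p) = 1 := congrArg UnitsCarrier.val h3
  have h5 : (2 : PadicAlgCl p) = 0 := by
    have := congrArg (fun x : PadicAlgCl p => x + 1) h4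
    simp only [neg_add_cancel] at this
    rw [one_add_one_eq_two] at this
    exact this.symm
  exact two_ne_zero h5

end TFModel

end Literature.AnabelianGeometry.AbsoluteAnabelian.AbsTopIII
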